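import Summits.HodgeConjecture.HodgeConjecture.Theorems.EightfoldBlochSeedsChernCharacterOnBettiAnalytificationExists
import HarnessLib

/-!
# K1 (analytification bridge), step 5: the structure sheaf — `𝒪_X(ℂ)` exists as a topological line
# bundle with comparison map, and EVERY topological analytification of `𝒪_X` has trivial Chern classes

Route `EightfoldBlochSeeds` / item `stmt-HodgeConjecture-19780` (`ChernCharacterOnBetti`), helper
(`--supports`). HONEST FRAMING: nothing here proves 19780 / 18880 / 18882 / 18883 / H2 / HC_AV / HC;
no definition, no named fact.

WHAT (the normalisation law `c(𝒪_X) = 1` of `ChernCharacterBetti.ch_free_zero/_of_pos`, rank-one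
case, integrally). The constant section `1` is an algebraic frame of `𝒪_X` over every open
(`HodgeTheory.isSectionFrame_structureSheaf_one`, PROVED in the tree), so:

* `exists_topologicalAnalytification_structureSheaf` — `𝒪_X` has a topological analytification
  `(E, α)` of rank `1` on `X(ℂ)` (step 2 with `r = 1`);
* `chernClassZ_eq_zero_of_comparison_structureSheaf` — for ANY complex vector bundle `E` on `X(ℂ)`
  with comparison maps for `𝒪_X` (continuous, frames ↦ bases), over a Hausdorff paracompact `X(ℂ)`:
  `cᵢ(E) = 0` for `i ≥ 1` — the global frame `α(1)` is a continuous nowhere-zero section, so `E` is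
  trivial (`ComplexVectorBundle.chernClassZ_eq_zero_of_frame`, Milnor–Stasheff §2 Thm. 2.2 +
  Husemoller Ch. 17 Prop. 4.1); and `c₀(E) = 1` (`chernClassZ_zero`);
* `exists_analytification_structureSheaf_chernClassZ` — packaged.

[cite: SerreGAGA1956, §3 n°9 Prop. 10 (𝒪^h = 𝓗)] [cite: HusemollerFibreBundles1994, Ch. 17 Prop. 4.1]
[cite: MilnorStasheff1974, §2 Thm. 2.2]
-/

noncomputable section

-- single-problem summit (Problem = Summit): the mandated namespace repeats `HodgeConjecture`.
set_option linter.dupNamespace false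

open CategoryTheory AlgebraicGeometry Bundle Topology
open Literature.AlgebraicGeometry.Motives Literature.AlgebraicGeometry.HodgeTheory
open Literature.AlgebraicTopology.SingularHomology Literature.AlgebraicTopology.CharacteristicClasses

namespace Summit.HodgeConjecture.HodgeConjecture.Theorems

variable {X : SchemeOver ℂ}

/-- **`𝒪_X(ℂ)` exists**: the structure sheaf has a topological analytification of rank `1` with
Serre's comparison map (every point lies in the open `⊤` with the frame `1`).
[cite: SerreGAGA1956, §3 n°9 Prop. 10] -/
theorem exists_topologicalAnalytification_structureSheaf :
    ∃ (E : ComplexVectorBundle.{0, 0} (ComplexPoints X))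
      (α : ∀ U : X.left.Opens, Γ(structureSheafModule X.left, U) → ∀ P : ComplexPoints X, E.E P),
      E.rank = 1 ∧
      (∀ (U : X.left.Opens) (σ τ : Γ(structureSheafModule X.left, U)) (P : ComplexPoints X),
          α U (σ + τ) P = α U σ P + α U τ P) ∧
      (∀ (U : X.left.Opens) (f : Γ(X.left, U)) (σ : Γ(structureSheafModule X.left, U))
          (P : ComplexPoints X) (h : P.pt ∈ U), α U (f • σ) P = P.eval U h f • α U σ P) ∧
      (∀ (U W : X.left.Opens) (hWU : W ≤ U) (σ : Γ(structureSheafModule X.left, U))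
          (P : ComplexPoints X), P.pt ∈ W →
          α W ((structureSheafModule X.left).presheaf.map (homOfLE hWU).op σ) P = α U σ P) ∧
      (∀ (U : X.left.Opens) (σ : Γ(structureSheafModule X.left, U)),
          ContinuousOn (fun P ↦ (⟨P, α U σ P⟩ : TotalSpace E.F E.E)) {P | P.pt ∈ U}) ∧
      (∀ (U : X.left.Opens) (t : Fin 1 → Γ(structureSheafModule X.left, U)),
          IsSectionFrame (structureSheafModule X.left) U t → ∀ P : ComplexPoints X,
          P.pt ∈ U → LinearIndependent ℂ (fun j ↦ α U (t j) P) ∧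
            ⊤ ≤ Submodule.span ℂ (Set.range fun j ↦ α U (t j) P)) :=
  exists_topologicalAnalytification fun _ ↦
    ⟨⊤, fun _ ↦ structureSheafModule.ofFun 1, trivial, isSectionFrame_structureSheaf_one ⊤⟩

/-- **Every topological analytification of `𝒪_X` has `cᵢ = 0` for `i ≥ 1`** (over a Hausdorff
paracompact `X(ℂ)`): the comparison image of the global frame `1` is a continuous global frame of
`E`, so `E` is trivial. [cite: MilnorStasheff1974, §2 Thm. 2.2]
[cite: HusemollerFibreBundles1994, Ch. 17 Prop. 4.1] -/
theorem chernClassZ_eq_zero_of_comparison_structureSheaf [T2Space (ComplexPoints X)]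
    [ParacompactSpace (ComplexPoints X)] (E : ComplexVectorBundle.{0, 0} (ComplexPoints X))
    (α : ∀ U : X.left.Opens, Γ(structureSheafModule X.left, U) → ∀ P : ComplexPoints X, E.E P)
    (hcont : ∀ (U : X.left.Opens) (σ : Γ(structureSheafModule X.left, U)),
      ContinuousOn (fun P ↦ (⟨P, α U σ P⟩ : TotalSpace E.F E.E)) {P | P.pt ∈ U})
    (hframe : ∀ (U : X.left.Opens) (t : Fin 1 → Γ(structureSheafModule X.left, U)),
      IsSectionFrame (structureSheafModule X.left) U t → ∀ P : ComplexPoints X,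
        P.pt ∈ U → LinearIndependent ℂ (fun j ↦ α U (t j) P) ∧
          ⊤ ≤ Submodule.span ℂ (Set.range fun j ↦ α U (t j) P))
    {i : ℕ} (hi : 0 < i) : chernClassZ E i = 0 := by
  have huniv : {P : ComplexPoints X | P.pt ∈ (⊤ : X.left.Opens)} = Set.univ :=
    Set.eq_univ_of_forall fun _ ↦ trivial
  refine ComplexVectorBundle.chernClassZ_eq_zero_of_frame E
    (fun j P ↦ α ⊤ ((fun _ : Fin 1 ↦ structureSheafModule.ofFun (1 : Γ(X.left, ⊤))) j) P)
    (fun j ↦ ?_) (fun P ↦ hframe ⊤ _ (isSectionFrame_structureSheaf_one ⊤) P trivial) hi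
  have h := hcont ⊤ ((fun _ : Fin 1 ↦ structureSheafModule.ofFun (1 : Γ(X.left, ⊤))) j)
  rw [huniv, continuousOn_univ] at h
  exact h

/-- … and `c₀ = 1` (for every bundle). [cite: HusemollerFibreBundles1994, Ch. 17 Prop. 3.3] -/
theorem chernClassZ_zero_of_comparison_structureSheaf (E : ComplexVectorBundle.{0, 0} (ComplexPoints X)) :
    chernClassZ E 0 = singularCohomology.one ℤ (ComplexPoints X) :=
  chernClassZ_zero E

/-- **K1g (rank one) packaged**: over a Hausdorff paracompact `X(ℂ)` (e.g. `X` smooth projective),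
`𝒪_X` has a topological analytification `(E, α)` of rank `1`, and for every such datum
`c₀(E) = 1`, `cᵢ(E) = 0` (`i ≥ 1`) in `H²ⁱ(X(ℂ); ℤ)` — the integral normalisation law
`c(𝒪_X(ℂ)) = 1`. [cite: SerreGAGA1956, §3 n°9 Prop. 10] [cite: HusemollerFibreBundles1994, Ch. 17 Prop. 4.1] -/
theorem exists_analytification_structureSheaf_chernClassZ [T2Space (ComplexPoints X)]
    [ParacompactSpace (ComplexPoints X)] :
    ∃ (E : ComplexVectorBundle.{0, 0} (ComplexPoints X))
      (α : ∀ U : X.left.Opens, Γ(structureSheafModule X.left, U) → ∀ P : ComplexPoints X, E.E P),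
      E.rank = 1 ∧
      (∀ (U : X.left.Opens) (σ τ : Γ(structureSheafModule X.left, U)) (P : ComplexPoints X),
          α U (σ + τ) P = α U σ P + α U τ P) ∧
      (∀ (U : X.left.Opens) (f : Γ(X.left, U)) (σ : Γ(structureSheafModule X.left, U))
          (P : ComplexPoints X) (h : P.pt ∈ U), α U (f • σ) P = P.eval U h f • α U σ P) ∧
      (∀ (U W : X.left.Opens) (hWU : W ≤ U) (σ : Γ(structureSheafModule X.left, U))
          (P : ComplexPoints X), P.pt ∈ W →
          α W ((structureSheafModule X.left).presheaf.map (homOfLE hWU).op σ) P = α U σ P) ∧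
      (∀ (U : X.left.Opens) (σ : Γ(structureSheafModule X.left, U)),
          ContinuousOn (fun P ↦ (⟨P, α U σ P⟩ : TotalSpace E.F E.E)) {P | P.pt ∈ U}) ∧
      (∀ (U : X.left.Opens) (t : Fin 1 → Γ(structureSheafModule X.left, U)),
          IsSectionFrame (structureSheafModule X.left) U t → ∀ P : ComplexPoints X,
          P.pt ∈ U → LinearIndependent ℂ (fun j ↦ α U (t j) P) ∧
            ⊤ ≤ Submodule.span ℂ (Set.range fun j ↦ α U (t j) P)) ∧
      chernClassZ E 0 = singularCohomology.one ℤ (ComplexPoints X) ∧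
      (∀ i : ℕ, 0 < i → chernClassZ E i = 0) := by
  obtain ⟨E, α, hrank, hadd, hsmul, hres, hcont, hframe⟩ :=
    exists_topologicalAnalytification_structureSheaf (X := X)
  exact ⟨E, α, hrank, hadd, hsmul, hres, hcont, hframe, chernClassZ_zero E, fun i hi ↦
    chernClassZ_eq_zero_of_comparison_structureSheaf E α hcont hframe hi⟩

end Summit.HodgeConjecture.HodgeConjecture.Theorems

end
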